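import Summits.HubbardSuperconductivity.HubbardSuperconductivity.Theses.AposterioriCapRg

/-!
# Crux `CapRgSymmetricCertificatePinned` (item `stmt-HubbardSuperconductivity-14045`, route
# `AposterioriCapRg`): the Schur bound on the pairing strength and the fat-shell necessary condition

Negative-side support lemmas from the standing disprover (cdisprove, cycle 1, 2026-08-16; part 1 of 2 —
part 2 is `B1gBlind.lean`; the full attack log is the crux workfile
`Cruxes/CapRgSymmetricCertificatePinned/Disproof.lean`).  Nothing here asserts a Theses decl;
everything is about the landed predicate `SymmetricCertifiedAtT` / `symmetricRegimeCertificateT`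
(D1′b-v3, `SymmetricRegimeCertificateT.lean`) for an ARBITRARY effective action `G`, and one corollary
consumes the crux as a hypothesis.

* §1 `re_neg_rayleigh_le_of_entry_bound`, `supRayleigh_neg_le_of_entry_bound` (Schur /
  Cauchy–Schwarz: `‖A i j‖ ≤ sᵢ C sⱼ ⇒ Re⟨v,-Av⟩, supRayleigh (-A) ≤ C Σ sᵢ²`), the sandwich
  bookkeeping `norm_sandwich_le`, `sum_indicator_sqrt_sq`, and
  `pairingStrength_le_of_amplitude_le`, `pairingStrength_le_vertexSupNorm_mul` —
  **`λ_d ≤ ‖𝒱₄‖_∞ · Σ_{k∈S_Λ} (√ν_k)²`**: clause (iii′) is dominated by clause (i′a) times the BCS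
  shell mass.
* §2 `not_symmetricCertifiedAtT_of_cooperAmplitude_eq_zero` — no certificate (any `a > 0`) when the
  Cooper amplitude vanishes on the shell (every purely quadratic `G`).
* §3 `bcsMeasure_mem_of_fieldStrength`, `card_shell_lower_bound`, `card_shell_ge_of_certificateT`,
  `capRg_forces_fat_shells` — the NECESSARY CONDITION `a · 2ζ Λ L² ≤ E₁ |S_Λ(L)|`, i.e.
  **`|S_Λ(L)| ≥ Λ L²/32`** at the pinned data `π₀ = capRgCornerDataT` for every certified `L ≥ L₀`
  (the last lemma consumes the crux `CapRgSymmetricCertificatePinned` as a HYPOTHESIS).  Physically met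
  with room (`Area{|e_K| ≤ Λ} ≈ 15Λ ≫ 4π²Λ/32`); recorded so that no certificate is attempted with a
  starved shell, and as the quantitative form of "the window needs density of states".

Sources: folklore (Schur test, Rayleigh quotients).  Tree API used: `Matrix.supRayleigh`,
`cooperMatrix`, `bcsMeasure`, `vertexSupNorm`, `norm_vertexFn_le_vertexSupNorm`,
`SymmetricCertifiedAtT.window/.quartic_le/.fieldStrength_mem`, `nambuXiCT_neg`,
`capRgCornerDataT_bounds`, `symmetricWindowLower`.
-/

noncomputable section

namespace Summit.HubbardSuperconductivity.CapRgSymmetricCertificatePinned.Negative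

open Literature.MathematicalPhysics.QuantumLattice Literature.Probability.LatticeModels Finset Matrix
open scoped BigOperators ComplexConjugate

/-! ## §1 The Schur bound: clause (iii′) is dominated by clause (i′a) times the BCS shell mass -/

section Schur

variable {m : Type*} [Fintype m]

/-- A `dotProduct`-unit vector has `Σ ‖vᵢ‖² = 1`. [folklore] -/
theorem sum_norm_sq_eq_one_of_unit {v : m → ℂ} (hv : star v ⬝ᵥ v = 1) : ∑ i, ‖v i‖ ^ 2 = 1 := by
  have h := congrArg Complex.re hv
  simp only [dotProduct, Pi.star_apply, Complex.star_def, Complex.conj_mul', Complex.re_sum,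
    Complex.one_re] at h
  simpa [← Complex.ofReal_pow, Complex.ofReal_re] using h

/-- **Schur / Cauchy–Schwarz bound, pointwise.**  If `‖A i j‖ ≤ sᵢ · C · sⱼ` with `C ≥ 0`, then the
Rayleigh quotient of `-A` at every `dotProduct`-unit vector is at most `C Σᵢ sᵢ²`. [folklore] -/
theorem re_neg_rayleigh_le_of_entry_bound (A : Matrix m m ℂ) (s : m → ℝ) (C : ℝ)
    (hC : 0 ≤ C) (hA : ∀ i j, ‖A i j‖ ≤ s i * C * s j) {v : m → ℂ} (hv : star v ⬝ᵥ v = 1) :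
    (star v ⬝ᵥ ((-A) *ᵥ v)).re ≤ C * ∑ i, s i ^ 2 := by
  have step1 : ‖star v ⬝ᵥ ((-A) *ᵥ v)‖ ≤ ∑ i, ‖v i‖ * ∑ j, ‖A i j‖ * ‖v j‖ := by
    unfold dotProduct
    refine (norm_sum_le _ _).trans (Finset.sum_le_sum fun i _ => ?_)
    rw [norm_mul, Pi.star_apply, norm_star]
    refine mul_le_mul_of_nonneg_left ?_ (norm_nonneg _)
    simp only [Matrix.mulVec, dotProduct, Matrix.neg_apply]
    refine (norm_sum_le _ _).trans (Finset.sum_le_sum fun j _ => ?_)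
    rw [norm_mul, norm_neg]
  have step2 : ∑ i, ‖v i‖ * ∑ j, ‖A i j‖ * ‖v j‖ ≤ ∑ i, ‖v i‖ * ∑ j, (s i * C * s j) * ‖v j‖ := by
    gcongr with i _ j _
    exact hA i j
  have step3 : ∑ i, ‖v i‖ * ∑ j, (s i * C * s j) * ‖v j‖ = C * (∑ i, s i * ‖v i‖) ^ 2 := by
    rw [sq, Finset.sum_mul_sum, Finset.mul_sum]
    refine Finset.sum_congr rfl fun i _ => ?_
    rw [Finset.mul_sum, Finset.mul_sum]
    refine Finset.sum_congr rfl fun j _ => ?_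
    ring
  have step4 : (∑ i, s i * ‖v i‖) ^ 2 ≤ (∑ i, s i ^ 2) * ∑ i, ‖v i‖ ^ 2 :=
    Finset.sum_mul_sq_le_sq_mul_sq _ _ _
  rw [sum_norm_sq_eq_one_of_unit hv, mul_one] at step4
  calc (star v ⬝ᵥ ((-A) *ᵥ v)).re ≤ ‖star v ⬝ᵥ ((-A) *ᵥ v)‖ := Complex.re_le_norm _
    _ ≤ C * (∑ i, s i * ‖v i‖) ^ 2 := by rw [← step3]; exact step1.trans step2
    _ ≤ C * ∑ i, s i ^ 2 := mul_le_mul_of_nonneg_left step4 hC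

/-- **Schur / Cauchy–Schwarz bound.**  If `‖A i j‖ ≤ sᵢ · C · sⱼ` with `C ≥ 0`, then
`supRayleigh (-A) ≤ C Σᵢ sᵢ²` (junk `0` on an empty index type included). [folklore] -/
theorem supRayleigh_neg_le_of_entry_bound (A : Matrix m m ℂ) (s : m → ℝ) (C : ℝ)
    (hC : 0 ≤ C) (hA : ∀ i j, ‖A i j‖ ≤ s i * C * s j) :
    (-A).supRayleigh ≤ C * ∑ i, s i ^ 2 := by
  have hrhs : 0 ≤ C * ∑ i, s i ^ 2 := mul_nonneg hC (Finset.sum_nonneg fun i _ => sq_nonneg _)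
  unfold Matrix.supRayleigh
  rcases isEmpty_or_nonempty {v : m → ℂ // star v ⬝ᵥ v = 1} with h | h
  · rw [Real.iSup_of_isEmpty]; exact hrhs
  · exact ciSup_le fun v => re_neg_rayleigh_le_of_entry_bound A s C hC hA v.2

/-- `Σᵢ sᵢ² = Σ_{i∈S} (√wᵢ)²` for the indicator-weighted square root `sᵢ = 𝟙_S(i) √wᵢ`. [folklore] -/
theorem sum_indicator_sqrt_sq [DecidableEq m] (S : Finset m) (w : m → ℝ) :
    ∑ i, (fun j => if j ∈ S then Real.sqrt (w j) else 0) i ^ 2 = ∑ i ∈ S, Real.sqrt (w i) ^ 2 := by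
  have : ∀ i, (fun j => if j ∈ S then Real.sqrt (w j) else 0) i ^ 2 =
      if i ∈ S then Real.sqrt (w i) ^ 2 else 0 := fun i => by
    by_cases hi : i ∈ S
    · simp only [if_pos hi]
    · simp only [if_neg hi]; ring
  simp_rw [this]
  rw [Finset.sum_ite, Finset.sum_const_zero, add_zero, Finset.filter_mem_eq_inter, Finset.univ_inter]

omit [Fintype m] in
/-- **Entry bound of a sandwiched kernel**: if `‖F k k′‖ ≤ C` on `S × S` then the matrix
`𝟙_S(k)𝟙_S(k′) √w_k F(k,k′) √w_{k′}` has entries bounded by `s_k C s_{k′}`, `s = 𝟙_S √w`. [folklore] -/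
theorem norm_sandwich_le [DecidableEq m] {S : Finset m} {w : m → ℝ} {F : m → m → ℂ} {C : ℝ}
    (hF : ∀ k ∈ S, ∀ k' ∈ S, ‖F k k'‖ ≤ C) (k k' : m) :
    ‖(if k ∈ S ∧ k' ∈ S then ((Real.sqrt (w k) : ℝ) : ℂ) * F k k' * ((Real.sqrt (w k') : ℝ) : ℂ) else 0)‖ ≤
      (fun j => if j ∈ S then Real.sqrt (w j) else 0) k * C *
        (fun j => if j ∈ S then Real.sqrt (w j) else 0) k' := by
  simp only []
  by_cases hk : k ∈ S
  · by_cases hk' : k' ∈ S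
    · rw [if_pos ⟨hk, hk'⟩, if_pos hk, if_pos hk', norm_mul, norm_mul,
        Complex.norm_real, Complex.norm_real, Real.norm_eq_abs, Real.norm_eq_abs,
        abs_of_nonneg (Real.sqrt_nonneg _), abs_of_nonneg (Real.sqrt_nonneg _)]
      exact mul_le_mul_of_nonneg_right (mul_le_mul_of_nonneg_left (hF k hk k' hk') (Real.sqrt_nonneg _))
        (Real.sqrt_nonneg _)
    · rw [if_neg (fun h => hk' h.2), if_pos hk, if_neg hk', norm_zero, mul_zero]
  · rw [if_neg (fun h => hk h.1), if_neg hk, norm_zero, zero_mul, zero_mul]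

end Schur

section Cooper

variable {L M : ℕ} [NeZero L] [NeZero M]

/-- **`λ_d ≤ C · Σ_{k ∈ S_Λ} (√ν_k)²` whenever `|𝒞(k,k′)| ≤ C` on `S_Λ × S_Λ`** (any `G`, any band, any
scale; `(√ν)² = ν` where `ν ≥ 0`, `= 0` where the BCS measure is negative junk). [folklore] -/
theorem pairingStrength_le_of_amplitude_le (β Λ : ℝ) (e : TorusSite 2 L → ℝ) (G : HubbardGrassmann L M)
    {C : ℝ} (hC : 0 ≤ C)
    (hamp : ∀ k ∈ momentumShell L e Λ, ∀ k' ∈ momentumShell L e Λ, ‖cooperAmplitude L M β G k k'‖ ≤ C) :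
    pairingStrength L M β e Λ G ≤
      C * ∑ k ∈ momentumShell L e Λ, Real.sqrt (bcsMeasure L M β Λ G k) ^ 2 := by
  classical
  have hA : ∀ k k', ‖cooperMatrix L M β e Λ G k k'‖ ≤
      (fun j => if j ∈ momentumShell L e Λ then Real.sqrt (bcsMeasure L M β Λ G j) else 0) k * C *
        (fun j => if j ∈ momentumShell L e Λ then Real.sqrt (bcsMeasure L M β Λ G j) else 0) k' := fun k k' => by
    rw [cooperMatrix, Matrix.of_apply]
    convert norm_sandwich_le (S := momentumShell L e Λ) (w := bcsMeasure L M β Λ G)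
      (F := cooperAmplitude L M β G) hamp k k' using 3
  rw [pairingStrength, ← sum_indicator_sqrt_sq]
  exact supRayleigh_neg_le_of_entry_bound _ _ C hC hA

/-- **`λ_d ≤ ‖𝒱₄‖_∞ · Σ_{k∈S_Λ} (√ν_k)²`** for every effective action `G`: the pairing strength (clause
(iii′)) is dominated by the quartic sup norm (clause (i′a)) times the BCS shell mass. [folklore] -/
theorem pairingStrength_le_vertexSupNorm_mul (β Λ : ℝ) (e : TorusSite 2 L → ℝ) (G : HubbardGrassmann L M) :
    pairingStrength L M β e Λ G ≤
      vertexSupNorm L M β G 4 * ∑ k ∈ momentumShell L e Λ, Real.sqrt (bcsMeasure L M β Λ G k) ^ 2 :=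
  pairingStrength_le_of_amplitude_le β Λ e G (vertexSupNorm_nonneg L M β G 4) fun k _ k' _ => by
    unfold cooperAmplitude
    exact norm_vertexFn_le_vertexSupNorm L M β G 4 _

/-! ## §2 No Cooper amplitude on the shell ⇒ no certificate (any data, any `a > 0`) -/

/-- If the Cooper amplitude vanishes on `S_Λ × S_Λ` then `λ_d ≤ 0`, so no interval with `a > 0`
certifies `G` — whatever the other clauses say.  (Every purely quadratic `G` is of this kind.) [folklore] -/
theorem not_symmetricCertifiedAtT_of_cooperAmplitude_eq_zero {π : SymmetricRegimeDataT}
    {Θ : SymmetricTolerance} {a b : ℚ} (ha : 0 < a) {Λ β : ℝ} {e : TorusSite 2 L → ℝ}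
    {G : HubbardGrassmann L M} {Z : ℂ}
    (h0 : ∀ k ∈ momentumShell L e Λ, ∀ k' ∈ momentumShell L e Λ, cooperAmplitude L M β G k k' = 0) :
    ¬ SymmetricCertifiedAtT π Θ a b Λ L M β e G Z := by
  intro h
  have h1 := h.window.1
  have h2 := pairingStrength_le_of_amplitude_le β Λ e G (le_refl (0 : ℝ))
    (fun k hk k' hk' => by rw [h0 k hk k' hk', norm_zero])
  rw [zero_mul] at h2
  have : (0 : ℝ) < a := by exact_mod_cast ha
  linarith

/-! ## §3 Certified shells are fat: `|S_Λ(L)| ≥ a · 2ζ · Λ L² / E₁` (`≥ ΛL²/32` at `π₀`) -/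

/-- Under the field-strength floor `ζ ≤ z(±k)` the BCS measure is in `[0, 1/(2ζΛL²)]`. [folklore] -/
theorem bcsMeasure_mem_of_fieldStrength {β Λ ζ : ℝ} (hΛ : 0 < Λ) (hζ : 0 < ζ) {G : HubbardGrassmann L M}
    {k : TorusSite 2 L} (hk : ζ ≤ fieldStrength L M β G k) (hk' : ζ ≤ fieldStrength L M β G (-k)) :
    0 ≤ bcsMeasure L M β Λ G k ∧ bcsMeasure L M β Λ G k ≤ 1 / (2 * ζ * Λ * (L : ℝ) ^ 2) := by
  have hL : (0 : ℝ) < (L : ℝ) ^ 2 := pow_pos (by exact_mod_cast NeZero.pos L) 2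
  have hz : 2 * ζ ≤ fieldStrength L M β G k + fieldStrength L M β G (-k) := by linarith
  have hpos : 0 < Λ * (L : ℝ) ^ 2 * (fieldStrength L M β G k + fieldStrength L M β G (-k)) :=
    mul_pos (mul_pos hΛ hL) (by linarith)
  refine ⟨by unfold bcsMeasure; positivity, ?_⟩
  unfold bcsMeasure
  rw [show 2 * ζ * Λ * (L : ℝ) ^ 2 = Λ * (L : ℝ) ^ 2 * (2 * ζ) by ring]
  exact one_div_le_one_div_of_le (by positivity) (mul_le_mul_of_nonneg_left hz (by positivity))

/-- **Fat-shell necessary condition (point form).**  A certificate at `(L, M, β)` for an EVEN band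
forces `a · (2ζ Λ L²) ≤ E₁ · |S_Λ|`: `a ≤ λ_d ≤ ‖𝒱₄‖_∞ Σ_{S} ν ≤ E₁ |S| /(2ζΛL²)`. [folklore] -/
theorem card_shell_lower_bound {π : SymmetricRegimeDataT} {Θ : SymmetricTolerance} {a b : ℚ}
    {Λ β : ℝ} {e : TorusSite 2 L → ℝ} {G : HubbardGrassmann L M} {Z : ℂ}
    (h : SymmetricCertifiedAtT π Θ a b Λ L M β e G Z) (he : ∀ k, e (-k) = e k) (hΛ : 0 < Λ) :
    (a : ℝ) * (2 * π.fieldFloor * Λ * (L : ℝ) ^ 2) ≤ π.quarticBound * (momentumShell L e Λ).card := by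
  set S := momentumShell L e Λ
  have hζ : (0 : ℝ) < π.fieldFloor := by exact_mod_cast π.fieldFloor_pos
  have hz : ∀ k ∈ S, (π.fieldFloor : ℝ) ≤ fieldStrength L M β G k := fun k hk => by
    have h0 := (h.fieldStrength_mem hk 0).1
    have h1 := (h.fieldStrength_mem hk 1).1
    unfold fieldStrength
    linarith
  have hneg : ∀ k ∈ S, -k ∈ S := fun k hk => by
    rw [mem_momentumShell] at hk ⊢
    rwa [he]
  have hν : ∀ k ∈ S, Real.sqrt (bcsMeasure L M β Λ G k) ^ 2 ≤ 1 / (2 * π.fieldFloor * Λ * (L : ℝ) ^ 2) := by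
    intro k hk
    obtain ⟨h0, h1⟩ := bcsMeasure_mem_of_fieldStrength hΛ hζ (hz k hk) (hz (-k) (hneg k hk))
    rw [Real.sq_sqrt h0]
    exact h1
  have hsum : ∑ k ∈ S, Real.sqrt (bcsMeasure L M β Λ G k) ^ 2 ≤
      S.card * (1 / (2 * π.fieldFloor * Λ * (L : ℝ) ^ 2)) :=
    (Finset.sum_le_sum hν).trans (by rw [Finset.sum_const, nsmul_eq_mul])
  have hE : (0 : ℝ) ≤ π.quarticBound := by exact_mod_cast π.quarticBound_pos.le
  have hchain : (a : ℝ) ≤ π.quarticBound * (S.card * (1 / (2 * π.fieldFloor * Λ * (L : ℝ) ^ 2))) :=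
    calc (a : ℝ) ≤ pairingStrength L M β e Λ G := h.window.1
      _ ≤ vertexSupNorm L M β G 4 * ∑ k ∈ S, Real.sqrt (bcsMeasure L M β Λ G k) ^ 2 :=
        pairingStrength_le_vertexSupNorm_mul β Λ e G
      _ ≤ π.quarticBound * ∑ k ∈ S, Real.sqrt (bcsMeasure L M β Λ G k) ^ 2 :=
        mul_le_mul_of_nonneg_right h.quartic_le (Finset.sum_nonneg fun k _ => sq_nonneg _)
      _ ≤ π.quarticBound * (S.card * (1 / (2 * π.fieldFloor * Λ * (L : ℝ) ^ 2))) :=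
        mul_le_mul_of_nonneg_left hsum hE
  have hD : 0 < 2 * (π.fieldFloor : ℝ) * Λ * (L : ℝ) ^ 2 := by
    have hL : (0 : ℝ) < (L : ℝ) ^ 2 := pow_pos (by exact_mod_cast NeZero.pos L) 2
    positivity
  rw [show (π.quarticBound : ℝ) * (S.card * (1 / (2 * π.fieldFloor * Λ * (L : ℝ) ^ 2))) =
      π.quarticBound * S.card / (2 * π.fieldFloor * Λ * (L : ℝ) ^ 2) by ring] at hchain
  exact (le_div_iff₀ hD).1 hchain

/-- **Fat-shell necessary condition for the model at the pinned data `π₀`.**  If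
`symmetricRegimeCertificateT U μ capRgCornerDataT Θ K Λ L₀` holds then for EVERY `L ≥ L₀` the
discrete shell `{k ∈ (ℤ/Lℤ)² : |e_K(k)| ≤ Λ}` has at least `Λ L²/32` points (`a ≥ 1/8`, `ζ = 1/2`,
`E₁ = 4`; the shell does not depend on `β, M`, so one certified `(β, M)` per `L` suffices). [folklore] -/
theorem card_shell_ge_of_certificateT {U μ : ℝ} {Θ : SymmetricTolerance} {K : TrigPolyC4v} {Λ : ℝ}
    {L₀ : ℕ} (h : symmetricRegimeCertificateT U μ capRgCornerDataT Θ K Λ L₀) :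
    ∀ L : ℕ, L₀ ≤ L → ∀ [NeZero L],
      Λ * (L : ℝ) ^ 2 / 32 ≤ ((momentumShell L (nambuXiCT L μ K) Λ).card : ℝ) := by
  intro L hL _
  obtain ⟨-, hΛ, -, a, b, ha, -, -, -, hblock⟩ := h
  obtain ⟨β₀, hβ₀⟩ := hblock L hL
  obtain ⟨M₀, hM₀⟩ := hβ₀ β₀ le_rfl
  haveI : NeZero (M₀ + 1) := ⟨Nat.succ_ne_zero _⟩
  have hc := hM₀ (M₀ + 1) (Nat.le_succ _)
  have key := card_shell_lower_bound hc (fun k => nambuXiCT_neg L μ K k) hΛ.pos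
  have hf : ((capRgCornerDataT.fieldFloor : ℚ) : ℝ) = 1 / 2 := by
    rw [capRgCornerDataT_bounds.2.2.1]; norm_num
  have hq : ((capRgCornerDataT.quarticBound : ℚ) : ℝ) = 4 := by
    rw [capRgCornerDataT_bounds.1]; norm_num
  rw [hf, hq] at key
  have ha' : (1 / 8 : ℝ) ≤ a := by
    have := (Rat.cast_le (K := ℝ)).2 ha
    simpa [symmetricWindowLower] using this
  have hΛL : 0 ≤ Λ * (L : ℝ) ^ 2 := mul_nonneg hΛ.pos.le (sq_nonneg _)
  nlinarith

/-- **Crux-level form**: `CapRgSymmetricCertificatePinned` hands, for every tolerance, a frame and a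
scale whose shells are eventually fat. (Necessary condition; physically met with room — recorded so that
no prover tries a certificate with a starved shell, e.g. `Λ L₀² < 32`.) [folklore] -/
theorem capRg_forces_fat_shells
    (h : Summit.HubbardSuperconductivity.HubbardSuperconductivity.Theses.AposterioriCapRg.CapRgSymmetricCertificatePinned) :
    ∃ U ∈ Set.Icc (2:ℝ) 3, ∃ μ : ℝ, ∀ Θ : SymmetricTolerance, ∃ (K : TrigPolyC4v) (Λ : ℝ) (L₀ : ℕ),
      0 < Λ ∧ ∀ L : ℕ, L₀ ≤ L → ∀ [NeZero L],
        Λ * (L : ℝ) ^ 2 / 32 ≤ ((momentumShell L (nambuXiCT L μ K) Λ).card : ℝ) := by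
  obtain ⟨U, hU, δ, -, μ, -, hcert⟩ := h
  refine ⟨U, hU, μ, fun Θ => ?_⟩
  obtain ⟨K, Λ, L₀, hc⟩ := hcert Θ
  exact ⟨K, Λ, L₀, hc.scale_pos, card_shell_ge_of_certificateT hc⟩

end Cooper

end Summit.HubbardSuperconductivity.CapRgSymmetricCertificatePinned.Negative

end
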